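import Literature.Analysis.Matrix.MultiplicativeSchwarz
import HarnessLib

/-!
# The chronological inverter: minimal residual extrapolation (MRE) is the Galerkin projection of
# the solution onto the span of the past solutions

R. C. Brower, T. Ivanenko, A. R. Levi, K. N. Orginos, *Chronological inversion method for the Dirac
matrix in hybrid Monte Carlo*, Nucl. Phys. B 484 (1997) 353–374 [BrowerEtAl1997] (held text
`paper:arxiv-hep-lat_9509012`, chunks p0003–p0004 = §III–§V).

**The method** (§IV–§V).  In the molecular-dynamics evolution of HMC one solves `A χ = φ`,
`A = M†M`, at every step; the *chronological inverter* starts the conjugate-gradient solver from a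
trial vector in the span of the `N` previous solutions `χ(t_1), …, χ(t_N)` — eq. (13)
`χ_trial = c_1 χ(t_1) + ⋯ + c_N χ(t_N)` — the older choices being the last solution, the linear
extrapolation `2χ(t_1) − χ(t_2)` or the polynomial extrapolation (14).  The MINIMAL RESIDUAL
EXTRAPOLATION chooses the coefficients "by minimizing the functional
`Ψ[χ] = χ†M†Mχ − φ†χ − χ†φ` (15), which is the same functional minimized by the Conjugated
Gradient method itself.  This corresponds to the minimization of the norm of the residual in the
norm of the inverse matrix, `r†(M†M)⁻¹r = Ψ[χ] + b†b` (16) … in the subspace spanned by `χ_i`",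
and "the minimization condition reduces to `Σ_j χ_i† M†M χ_j c_j = χ_i† φ`" (17).

**What is proved** (REAL symmetric positive (semi)definite `A`, Euclidean dot product — the tree's
convention for the whole Krylov thread; `-- TODO(general form)`: complex Hermitian `M†M`):
* `mreFunctional_eq_energy_sub` — eq. (16) without inverses: `Ψ[χ] = ‖x_* − χ‖_A² − (x_*, φ)`
  where `A x_* = φ` (`r†A⁻¹r = (x_* − χ)†A(x_* − χ)` since `r = A(x_* − χ)`,
  `residual_eq_mulVec_error`);
* `isMRE_iff_isGalerkinProj` — **minimising `Ψ` over a subspace `V` is the same as taking the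
  `A`-orthogonal (Galerkin) projection of the solution `x_*` onto `V`** (the object of
  `MultiplicativeSchwarz.IsGalerkinProj`, Saad's Proposition 5.2 for a general subspace); hence
  (`exists_isMRE`, `IsMRE.unique`) the MRE trial vector exists and is unique for `A ≻ 0`;
* `IsMRE.galerkin` / `isMRE_of_galerkin_range` — **eq. (17)**: the minimiser is characterised by
  the normal equations `(χ_i, φ − A χ_trial) = 0` on the spanning family;
* `IsMRE.energy_error_le` — the MRE trial vector has the SMALLEST `A`-norm error among all vectors
  of the span; in particular (`IsMRE.energy_error_le_combination`) it is at least as good, in that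
  norm, as the previous solution, the linear extrapolation and every polynomial extrapolation (13)–(14)
  built from the same past solutions;
* `solution_eq_of_mulVec_eq` — the logical content of §III's reversibility remark: the EXACT solution
  does not depend on the trial vector ("only if the CG has converged exactly to the fixed point …
  there will be no violation of time reversal invariance"); any history dependence of the returned
  vector is therefore entirely a finite-stopping-residual effect (the size of that effect is what
  `ResidualErrorBound.lean` bounds; the paper's measured thresholds `R ≤ 10⁻¹⁴` are numerics and are
  NOT restated here).

Not formalised: the Gram–Schmidt/Gauss–Jordan implementation of §V and its round-off discussion,
CG iteration counts or any performance figure, the leapfrog dynamics.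

## References
* [BrowerEtAl1997] R. C. Brower, T. Ivanenko, A. R. Levi, K. N. Orginos, Nucl. Phys. B 484 (1997)
  353–374, §III (reversibility paragraph), §IV eqs. (13)–(17), §V (MRE Algorithm).
* [Saad2003] Y. Saad, *Iterative Methods for Sparse Linear Systems*, 2nd ed., SIAM (2003), §5.2
  Proposition 5.2 (through `MultiplicativeSchwarz.lean`).
-/

noncomputable section

open scoped Matrix
open Finset

namespace Literature.Analysis.Matrix

namespace ChronologicalInverter

open _root_.Matrix Schwarz

variable {ι : Type*} [Fintype ι]

/-- `(x, Mᵀ y) = (y, M x)`. [folklore] -/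
private theorem dotProduct_transpose_mulVec (M : Matrix ι ι ℝ) (x y : ι → ℝ) :
    x ⬝ᵥ Mᵀ *ᵥ y = y ⬝ᵥ M *ᵥ x := by
  rw [mulVec_transpose, dotProduct_comm, ← dotProduct_mulVec]

/-- For symmetric `A`: `(x, A y) = (y, A x)`. [folklore] -/
private theorem dotA_symm {A : Matrix ι ι ℝ} (hA : Aᵀ = A) (x y : ι → ℝ) :
    x ⬝ᵥ A *ᵥ y = y ⬝ᵥ A *ᵥ x := by
  rw [← dotProduct_transpose_mulVec A y x, hA]

/-- **The MRE functional** `Ψ[χ] = χ†Aχ − φ†χ − χ†φ` (real form: `(χ, Aχ) − 2(φ, χ)`), `A = M†M`.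
[cite: BrowerEtAl1997, §IV eq. (15)] -/
def mreFunctional (A : Matrix ι ι ℝ) (φ χ : ι → ℝ) : ℝ :=
  χ ⬝ᵥ A *ᵥ χ - 2 * (φ ⬝ᵥ χ)

/-- Unfolding `Ψ`. [cite: BrowerEtAl1997, §IV eq. (15)] -/
theorem mreFunctional_def (A : Matrix ι ι ℝ) (φ χ : ι → ℝ) :
    mreFunctional A φ χ = χ ⬝ᵥ A *ᵥ χ - 2 * (φ ⬝ᵥ χ) := rfl

/-- The residual of a trial vector is `A` times its error: `r = φ − Aχ = A(x_* − χ)`.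
[cite: BrowerEtAl1997, §IV (text after eq. (16): `r = φ − M†Mχ`)] -/
theorem residual_eq_mulVec_error {A : Matrix ι ι ℝ} {φ xs : ι → ℝ} (hx : A *ᵥ xs = φ)
    (χ : ι → ℝ) : φ - A *ᵥ χ = A *ᵥ (xs - χ) := by
  rw [mulVec_sub, hx]

/-- **Eq. (16) without inverses**: `Ψ[χ] = ‖x_* − χ‖_A² − (x_*, φ)` for symmetric `A` and
`A x_* = φ` — i.e. `r†A⁻¹r = (x_* − χ, A(x_* − χ)) = Ψ[χ] + b†b` with `b†b = φ†A⁻¹φ = (x_*, φ)`.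
[cite: BrowerEtAl1997, §IV eq. (16)] -/
theorem mreFunctional_eq_energy_sub {A : Matrix ι ι ℝ} (hA : Aᵀ = A) {φ xs : ι → ℝ}
    (hx : A *ᵥ xs = φ) (χ : ι → ℝ) :
    mreFunctional A φ χ = (xs - χ) ⬝ᵥ A *ᵥ (xs - χ) - xs ⬝ᵥ φ := by
  have h1 : χ ⬝ᵥ A *ᵥ xs = φ ⬝ᵥ χ := by rw [hx, dotProduct_comm]
  have h2 : xs ⬝ᵥ A *ᵥ χ = φ ⬝ᵥ χ := by rw [dotA_symm hA, h1]
  have h3 : xs ⬝ᵥ A *ᵥ xs = xs ⬝ᵥ φ := by rw [hx]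
  rw [mreFunctional, mulVec_sub, sub_dotProduct, dotProduct_sub, dotProduct_sub, h1, h2, h3]
  ring

/-- `r†A⁻¹r` in inverse-free form: `(x_* − χ, r) = ‖x_* − χ‖_A²`. [cite: BrowerEtAl1997, §IV eq.
(16)] -/
theorem error_dotProduct_residual {A : Matrix ι ι ℝ} {φ xs : ι → ℝ} (hx : A *ᵥ xs = φ)
    (χ : ι → ℝ) : (xs - χ) ⬝ᵥ (φ - A *ᵥ χ) = (xs - χ) ⬝ᵥ A *ᵥ (xs - χ) := by
  rw [residual_eq_mulVec_error hx]

/-- **The minimal residual extrapolation**: `χ` lies in the subspace `V` (the span of the past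
solutions) and minimises `Ψ` there. [cite: BrowerEtAl1997, §IV (eqs. (13), (15)) and §V ("returns a
vector `χ_trial` that minimizes `Ψ[χ]` in the span(`χ_i`)")] -/
structure IsMRE (A : Matrix ι ι ℝ) (φ : ι → ℝ) (V : Submodule ℝ (ι → ℝ)) (χ : ι → ℝ) : Prop where
  /-- `χ ∈ V` -/
  mem : χ ∈ V
  /-- `Ψ[χ] ≤ Ψ[w]` for all `w ∈ V` -/
  le : ∀ w ∈ V, mreFunctional A φ χ ≤ mreFunctional A φ w

/-- **MRE = Galerkin projection of the solution.**  For symmetric `A ⪰ 0` with `A x_* = φ`: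
`χ` minimises `Ψ` over `V` iff `χ` is the `A`-orthogonal projection of `x_*` onto `V` (Saad's
orthogonal projection method with `𝒦 = ℒ = V`; Proposition 5.2 for a general subspace) — "the same
functional minimized by the Conjugated Gradient method itself", there with `V` a Krylov space.
[cite: BrowerEtAl1997, §IV eqs. (15)–(17); Saad2003, §5.2 Proposition 5.2] -/
theorem isMRE_iff_isGalerkinProj {A : Matrix ι ι ℝ} (hA : Aᵀ = A) (hnn : ∀ u, 0 ≤ u ⬝ᵥ A *ᵥ u)
    {φ xs : ι → ℝ} (hx : A *ᵥ xs = φ) {V : Submodule ℝ (ι → ℝ)} {χ : ι → ℝ} :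
    IsMRE A φ V χ ↔ IsGalerkinProj A V xs χ := by
  constructor
  · intro h
    refine IsGalerkinProj.of_best_approx hA hnn h.mem fun w hw => ?_
    have := h.le w hw
    rw [mreFunctional_eq_energy_sub hA hx, mreFunctional_eq_energy_sub hA hx] at this
    linarith
  · intro h
    refine ⟨h.mem, fun w hw => ?_⟩
    rw [mreFunctional_eq_energy_sub hA hx, mreFunctional_eq_energy_sub hA hx]
    linarith [h.best_approx hA hnn hw]

/-- **The MRE trial vector exists** for `A ≻ 0` and every subspace. [cite: BrowerEtAl1997, §V
(MRE Algorithm: "Solve `G a = b`"); Saad2003, §5.1 Proposition 5.1 (i)] -/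
theorem exists_isMRE {A : Matrix ι ι ℝ} (hA : A.PosDef) (φ : ι → ℝ) (V : Submodule ℝ (ι → ℝ)) :
    ∃ χ, IsMRE A φ V χ := by
  classical
  have hAt : Aᵀ = A := KyFan.transpose_eq hA.1
  have hnn : ∀ u : ι → ℝ, 0 ≤ u ⬝ᵥ A *ᵥ u := fun u => by
    have h := hA.posSemidef.dotProduct_mulVec_nonneg u
    rwa [star_trivial] at h
  obtain ⟨xs, hxs⟩ := (mulVec_surjective_iff_isUnit.mpr hA.isUnit) φ
  obtain ⟨χ, hχ⟩ := exists_isGalerkinProj hA V xs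
  exact ⟨χ, (isMRE_iff_isGalerkinProj hAt hnn hxs).mpr hχ⟩

/-- **… and is unique** (the Gram matrix `G_{nm} = v_n† A v_m` of a basis is nonsingular).
[cite: BrowerEtAl1997, §V (MRE Algorithm); Saad2003, §5.1 Proposition 5.1 (i)] -/
theorem IsMRE.unique {A : Matrix ι ι ℝ} (hA : A.PosDef) {φ : ι → ℝ} {V : Submodule ℝ (ι → ℝ)}
    {χ χ' : ι → ℝ} (h : IsMRE A φ V χ) (h' : IsMRE A φ V χ') : χ = χ' := by
  classical
  have hAt : Aᵀ = A := KyFan.transpose_eq hA.1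
  have hnn : ∀ u : ι → ℝ, 0 ≤ u ⬝ᵥ A *ᵥ u := fun u => by
    have h := hA.posSemidef.dotProduct_mulVec_nonneg u
    rwa [star_trivial] at h
  obtain ⟨xs, hxs⟩ := (mulVec_surjective_iff_isUnit.mpr hA.isUnit) φ
  exact ((isMRE_iff_isGalerkinProj hAt hnn hxs).mp h).unique hA
    ((isMRE_iff_isGalerkinProj hAt hnn hxs).mp h')

/-- **Eq. (17), the normal equations**: the MRE vector satisfies `(w, φ − Aχ) = 0` for every `w`
in the span — in particular `Σ_j (χ_i, A χ_j) c_j = (χ_i, φ)` for the past solutions `χ_i`.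
[cite: BrowerEtAl1997, §IV eq. (17)] -/
theorem IsMRE.galerkin {A : Matrix ι ι ℝ} (hA : Aᵀ = A) (hnn : ∀ u, 0 ≤ u ⬝ᵥ A *ᵥ u)
    {φ xs : ι → ℝ} (hx : A *ᵥ xs = φ) {V : Submodule ℝ (ι → ℝ)} {χ : ι → ℝ} (h : IsMRE A φ V χ)
    {w : ι → ℝ} (hw : w ∈ V) : w ⬝ᵥ (φ - A *ᵥ χ) = 0 := by
  rw [residual_eq_mulVec_error hx]
  exact ((isMRE_iff_isGalerkinProj hA hnn hx).mp h).orth w hw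

/-- **Eq. (17) characterises the minimiser**: if `χ ∈ span{χ_1, …, χ_N}` and the `N` normal
equations `(χ_i, φ − Aχ) = 0` hold, then `χ` is the MRE vector (the conditions on a spanning family
extend to the span by linearity). [cite: BrowerEtAl1997, §IV eq. (17) with §V] -/
theorem isMRE_of_galerkin_range {A : Matrix ι ι ℝ} (hA : Aᵀ = A) (hnn : ∀ u, 0 ≤ u ⬝ᵥ A *ᵥ u)
    {φ xs : ι → ℝ} (hx : A *ᵥ xs = φ) {N : ℕ} (past : Fin N → ι → ℝ) {χ : ι → ℝ}
    (hmem : χ ∈ Submodule.span ℝ (Set.range past))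
    (hnormal : ∀ i, past i ⬝ᵥ (φ - A *ᵥ χ) = 0) :
    IsMRE A φ (Submodule.span ℝ (Set.range past)) χ := by
  rw [isMRE_iff_isGalerkinProj hA hnn hx]
  refine ⟨hmem, fun w hw => ?_⟩
  rw [← residual_eq_mulVec_error hx]
  refine Submodule.span_induction (p := fun w _ => w ⬝ᵥ (φ - A *ᵥ χ) = 0) ?_ ?_ ?_ ?_ hw
  · rintro _ ⟨i, rfl⟩
    exact hnormal i
  · exact zero_dotProduct _
  · intro u v _ _ hu hv
    rw [add_dotProduct, hu, hv, add_zero]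
  · intro c u _ hu
    rw [smul_dotProduct, hu, smul_zero]

/-- **MRE has the smallest `A`-norm error in the span**: `‖x_* − χ_MRE‖_A ≤ ‖x_* − w‖_A` for every
`w ∈ V` (squared). [cite: BrowerEtAl1997, §IV eq. (16) ("minimization of the norm of the residual
in the norm of the inverse matrix … in the subspace"); Saad2003, §5.2 Proposition 5.2] -/
theorem IsMRE.energy_error_le {A : Matrix ι ι ℝ} (hA : Aᵀ = A) (hnn : ∀ u, 0 ≤ u ⬝ᵥ A *ᵥ u)
    {φ xs : ι → ℝ} (hx : A *ᵥ xs = φ) {V : Submodule ℝ (ι → ℝ)} {χ : ι → ℝ} (h : IsMRE A φ V χ)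
    {w : ι → ℝ} (hw : w ∈ V) :
    (xs - χ) ⬝ᵥ A *ᵥ (xs - χ) ≤ (xs - w) ⬝ᵥ A *ᵥ (xs - w) :=
  ((isMRE_iff_isGalerkinProj hA hnn hx).mp h).best_approx hA hnn hw

/-- **MRE beats every extrapolation from the same past solutions** (in the `A`-norm of the error):
for any coefficients `c` — the previous solution (`c = (1, 0, …)`), the linear extrapolation
`2χ(t_1) − χ(t_2)`, the polynomial extrapolation (14), … — the trial vector `Σ_k c_k χ(t_k)` of eq.
(13) has `A`-norm error at least that of the MRE vector over `span{χ(t_k)}`.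
[cite: BrowerEtAl1997, §IV eqs. (13)–(16)] -/
theorem IsMRE.energy_error_le_combination {A : Matrix ι ι ℝ} (hA : Aᵀ = A)
    (hnn : ∀ u, 0 ≤ u ⬝ᵥ A *ᵥ u) {φ xs : ι → ℝ} (hx : A *ᵥ xs = φ) {N : ℕ}
    (past : Fin N → ι → ℝ) {χ : ι → ℝ} (h : IsMRE A φ (Submodule.span ℝ (Set.range past)) χ)
    (c : Fin N → ℝ) :
    (xs - χ) ⬝ᵥ A *ᵥ (xs - χ) ≤
      (xs - ∑ k, c k • past k) ⬝ᵥ A *ᵥ (xs - ∑ k, c k • past k) := by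
  refine h.energy_error_le hA hnn hx (Submodule.sum_mem _ fun k _ => ?_)
  exact Submodule.smul_mem _ _ (Submodule.subset_span ⟨k, rfl⟩)

/-- `Ψ` itself is minimal at the MRE vector among all combinations (13). [cite: BrowerEtAl1997, §IV
eqs. (13), (15)] -/
theorem IsMRE.mreFunctional_le_combination {A : Matrix ι ι ℝ} {φ : ι → ℝ} {N : ℕ}
    (past : Fin N → ι → ℝ) {χ : ι → ℝ} (h : IsMRE A φ (Submodule.span ℝ (Set.range past)) χ)
    (c : Fin N → ℝ) :
    mreFunctional A φ χ ≤ mreFunctional A φ (∑ k, c k • past k) := by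
  refine h.le _ (Submodule.sum_mem _ fun k _ => ?_)
  exact Submodule.smul_mem _ _ (Submodule.subset_span ⟨k, rfl⟩)

/-- **The exact solution does not remember the trial vector** — the logical core of the
reversibility discussion: two exact solutions of `A χ = φ` coincide (`A ≻ 0`), so a force computed
from an EXACTLY converged solve is a function of the gauge field alone, whatever chronological guess
started the solver; "only if the CG has converged exactly to the fixed point of the conjugate
gradient iterations, there will be no violation of time reversal invariance" — every history
dependence is a finite-stopping-residual effect. [cite: BrowerEtAl1997, §III (paragraph "A critical
issue is the requirement to converge accurately …")] -/
theorem solution_eq_of_mulVec_eq [DecidableEq ι] {A : Matrix ι ι ℝ} (hA : A.PosDef)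
    {φ χ₁ χ₂ : ι → ℝ} (h₁ : A *ᵥ χ₁ = φ) (h₂ : A *ᵥ χ₂ = φ) : χ₁ = χ₂ :=
  (mulVec_injective_iff_isUnit.mpr hA.isUnit) (h₁.trans h₂.symm)

end ChronologicalInverter

end Literature.Analysis.Matrix
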